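/-
Copyright: the b2b-balaban T⁴-continuum CRUX team, row NE7b OWNER lineage `t4-ne7b-p1` (gen 106). Project licence.
-/
import Literature.Analysis.FunctionSpaces.UniformlyConvexPoincare

/-!
# SUPPLIERS OF THE CONVEXITY LETTER: the first-order uniform-convexity modulus is ADDITIVE, a coercive symmetric quadratic form
# `⟪x, Ax⟫` has modulus `2σ`, and a semiconvex (Hessian `≥ −h`) perturbation lowers it to `2σ − h` — «Hessian-small ⇒ the convexity
# road applies» as kernel lemmas (row NE7b, node U5c; residual (R2′) family (2); folklore calculus on `EuclideanSpace ℝ (Fin n)`)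

Cell `pub-balaban`, sub-cell `t4`, spine estimate NE7b (`T4WeightBudget.RelWeightBound`; the cell's OWN estimate — NOT PRINTED in
[Bałaban 1983–89], NOT PROVED).  Crux-route work under `Spine/NE7b/` by the row's OWNER; NOTHING of Bałaban's is named or asserted;
no `T4Continuum/Support` leaf typed; no `def`; zero `sorry`.

WHY.  `…NE7b.ConvexTiltMoment` (the convexity road, T-60a′ as theorems) consumes ONE letter about the exponent `V` of the tilted
density: the FIRST-ORDER uniform convexity `V x + ⟪∇V x, y − x⟫ + (λ∕2)‖y − x‖² ≤ V y` of the tree's Brascamp–Lieb theorem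
(`Literature.Probability.Moments.variance_tilted_le`).  For the family the refuter priced (PRICING-NE7b v70 F388 κ-g67-3 (a)(β), v71 F389):
`V = zᵀ(S − Q)z + V_β` with `S − Q` COERCIVE (`≥ σ = c₀ − q₀` per coordinate) and `V_β` the anharmonic remainder with a SMALL HESSIAN
(`D²V_β ≥ −h`, `h ≲ C·ε_k`), whence «`λ₁ ≥ 2(c₀ − q₀) − Cε_k`».  THIS FILE proves that sentence as lemmas: (§1) the modulus is ADDITIVE
under sums of differentiable functions (a semiconvex summand carries a NEGATIVE modulus); (§2) the quadratic form `x ↦ ⟪x, A x⟫` of a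
symmetric bounded operator with `⟪v, A v⟫ ≥ σ‖v‖²` has gradient `2Ax` and modulus `2σ` (exact identity); (§3) `⟪x, Ax⟫ + P x` with `P`
differentiable of modulus `−h` has modulus `2σ − h`, and with `P ∈ C²`, `D²P(x)[v,v] ≥ −h‖v‖²` the same via the tree's
`Literature.Analysis.FunctionSpaces.firstOrder_convex_of_hessian_lower` (which allows a negative constant).

WHAT IS PROVED ([folklore]; `HasFDerivAt.inner`, the Riesz map `InnerProductSpace.toDual`, the tree's Hessian ⟹ first-order lemma):
`hasGradientAt_of_hasFDerivAt_toDual`, **`firstOrder_add`**, `hasGradientAt_quadratic`, `gradient_quadratic`, **`firstOrder_quadratic`**,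
`differentiable_quadratic`, **`firstOrder_quadratic_add`**, **`firstOrder_quadratic_add_of_hessian`**.

NOT HERE (honest): the coercivity `σ` and the Hessian bound `h` of Bałaban's small-field exponents ((A1c) readings; the refuter's
`c₀ − q₀` and `C·ε_k`); the transport between `EuclideanSpace ℝ (Fin n)` and the `Fin n → ℝ` ∕ `Matrix` letters of the Gaussian share;
anything of Bałaban's.  NE7b NOT PRINTED ∕ NOT PROVED; spine PROVED 0∕9; rung (B)+1 on a FINITE torus — NOT infinite volume, NOT the mass
gap, NOT Clay.
HONEST DEPENDENCY: continuum YM on T⁴ ⇐ BetaPertH ∧ nine spine estimates (0/9 proved); BetaPertH ⇐ (D1) ∧ (D4) ∧ CAP+tail.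
-/

set_option autoImplicit false

noncomputable section

open Real InnerProductSpace
open scoped RealInnerProductSpace Gradient
open Literature.Analysis.FunctionSpaces

namespace Summit.QuantumFields.BalabanUV.T4Continuum.NE7b.ConvexTiltSuppliers

variable {n : ℕ}

/-! ## §1 The first-order modulus is additive -/

/-- A Fréchet derivative written through the Riesz map is a gradient. [folklore] -/
theorem hasGradientAt_of_hasFDerivAt_toDual {f : EuclideanSpace ℝ (Fin n) → ℝ} {g x : EuclideanSpace ℝ (Fin n)}
    (h : HasFDerivAt f (toDual ℝ (EuclideanSpace ℝ (Fin n)) g) x) : HasGradientAt f g x :=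
  hasGradientAt_iff_hasFDerivAt.2 h

/-- **THE FIRST-ORDER MODULUS IS ADDITIVE**: if `V₁`, `V₂` are differentiable with first-order moduli `λ₁`, `λ₂` (any signs — a
semiconvex summand carries a negative modulus), then `V₁ + V₂` has modulus `λ₁ + λ₂`. [folklore] -/
theorem firstOrder_add {V₁ V₂ : EuclideanSpace ℝ (Fin n) → ℝ} {l₁ l₂ : ℝ} (h₁ : Differentiable ℝ V₁) (h₂ : Differentiable ℝ V₂)
    (hV₁ : ∀ x y : EuclideanSpace ℝ (Fin n), V₁ x + ⟪gradient V₁ x, y - x⟫ + l₁ / 2 * ‖y - x‖ ^ 2 ≤ V₁ y)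
    (hV₂ : ∀ x y : EuclideanSpace ℝ (Fin n), V₂ x + ⟪gradient V₂ x, y - x⟫ + l₂ / 2 * ‖y - x‖ ^ 2 ≤ V₂ y)
    (x y : EuclideanSpace ℝ (Fin n)) :
    (V₁ x + V₂ x) + ⟪gradient (fun z => V₁ z + V₂ z) x, y - x⟫ + (l₁ + l₂) / 2 * ‖y - x‖ ^ 2 ≤ V₁ y + V₂ y := by
  have hg : gradient (fun z => V₁ z + V₂ z) x = gradient V₁ x + gradient V₂ x := by
    have e1 := (h₁ x).hasGradientAt
    have e2 := (h₂ x).hasGradientAt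
    rw [hasGradientAt_iff_hasFDerivAt] at e1 e2
    have e12 := e1.add e2
    rw [← map_add] at e12
    exact (hasGradientAt_of_hasFDerivAt_toDual e12).gradient
  rw [hg, inner_add_left]
  have a := hV₁ x y
  have b := hV₂ x y
  linarith

/-! ## §2 The quadratic form of a coercive symmetric operator -/

/-- **THE GRADIENT OF `x ↦ ⟪x, A x⟫` IS `2·A x`** for a bounded operator `A` symmetric in the real inner product. [folklore] -/
theorem hasGradientAt_quadratic (A : EuclideanSpace ℝ (Fin n) →L[ℝ] EuclideanSpace ℝ (Fin n))
    (hA : ∀ v w : EuclideanSpace ℝ (Fin n), ⟪A v, w⟫ = ⟪v, A w⟫) (x : EuclideanSpace ℝ (Fin n)) :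
    HasGradientAt (fun z : EuclideanSpace ℝ (Fin n) => ⟪z, A z⟫) ((2 : ℝ) • A x) x := by
  have hF : HasFDerivAt (fun z : EuclideanSpace ℝ (Fin n) => ⟪z, A z⟫)
      ((fderivInnerCLM ℝ (x, A x)).comp ((ContinuousLinearMap.id ℝ (EuclideanSpace ℝ (Fin n))).prod A)) x :=
    (hasFDerivAt_id x).inner ℝ A.hasFDerivAt
  have he : (fderivInnerCLM ℝ (x, A x)).comp ((ContinuousLinearMap.id ℝ (EuclideanSpace ℝ (Fin n))).prod A) =
      toDual ℝ (EuclideanSpace ℝ (Fin n)) ((2 : ℝ) • A x) := by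
    ext v
    simp only [ContinuousLinearMap.comp_apply, ContinuousLinearMap.prod_apply, ContinuousLinearMap.id_apply, fderivInnerCLM_apply,
      InnerProductSpace.toDual_apply_apply, real_inner_smul_left]
    rw [← hA x v, real_inner_comm (A x) v]
    ring
  rw [he] at hF
  exact hasGradientAt_of_hasFDerivAt_toDual hF

/-- Hence `gradient (x ↦ ⟪x, Ax⟫) x = 2·A x` and the form is differentiable. [folklore] -/
theorem gradient_quadratic (A : EuclideanSpace ℝ (Fin n) →L[ℝ] EuclideanSpace ℝ (Fin n))
    (hA : ∀ v w : EuclideanSpace ℝ (Fin n), ⟪A v, w⟫ = ⟪v, A w⟫) (x : EuclideanSpace ℝ (Fin n)) :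
    gradient (fun z : EuclideanSpace ℝ (Fin n) => ⟪z, A z⟫) x = (2 : ℝ) • A x :=
  (hasGradientAt_quadratic A hA x).gradient

/-- **A COERCIVE SYMMETRIC QUADRATIC FORM HAS MODULUS `2σ`** (exact second-order identity):
`⟪x,Ax⟫ + ⟪2Ax, y − x⟫ + σ‖y − x‖² ≤ ⟪y,Ay⟫` whenever `⟪v, Av⟫ ≥ σ‖v‖²`. [folklore] -/
theorem firstOrder_quadratic (A : EuclideanSpace ℝ (Fin n) →L[ℝ] EuclideanSpace ℝ (Fin n)) {σ : ℝ}
    (hA : ∀ v w : EuclideanSpace ℝ (Fin n), ⟪A v, w⟫ = ⟪v, A w⟫) (hσ : ∀ v : EuclideanSpace ℝ (Fin n), σ * ‖v‖ ^ 2 ≤ ⟪v, A v⟫)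
    (x y : EuclideanSpace ℝ (Fin n)) :
    ⟪x, A x⟫ + ⟪gradient (fun z : EuclideanSpace ℝ (Fin n) => ⟪z, A z⟫) x, y - x⟫ + (2 * σ) / 2 * ‖y - x‖ ^ 2 ≤ ⟪y, A y⟫ := by
  rw [gradient_quadratic A hA x]
  have hv := hσ (y - x)
  -- the exact identity `⟪y,Ay⟫ = ⟪x,Ax⟫ + 2⟪Ax, y−x⟫ + ⟪y−x, A(y−x)⟫`
  have hid : ⟪y, A y⟫ = ⟪x, A x⟫ + (2 : ℝ) * ⟪A x, y - x⟫ + ⟪y - x, A (y - x)⟫ := by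
    have ey : y = x + (y - x) := by abel
    conv_lhs => rw [ey]
    rw [map_add, inner_add_left, inner_add_right, inner_add_right, ← hA x (y - x), real_inner_comm (A x) (y - x)]
    ring
  rw [hid, real_inner_smul_left]
  nlinarith [hv]

/-! ## §3 Quadratic form plus a semiconvex perturbation: «Hessian-small ⇒ uniformly convex» -/

/-- The quadratic form of a bounded symmetric operator is differentiable. [folklore] -/
theorem differentiable_quadratic (A : EuclideanSpace ℝ (Fin n) →L[ℝ] EuclideanSpace ℝ (Fin n))
    (hA : ∀ v w : EuclideanSpace ℝ (Fin n), ⟪A v, w⟫ = ⟪v, A w⟫) :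
    Differentiable ℝ (fun z : EuclideanSpace ℝ (Fin n) => ⟪z, A z⟫) :=
  fun x => (hasGradientAt_quadratic A hA x).differentiableAt

/-- **COERCIVE QUADRATIC FORM PLUS A SEMICONVEX PERTURBATION**: if `⟪v, Av⟫ ≥ σ‖v‖²` (`A` symmetric) and `P` is differentiable with
first-order modulus `−h` (semiconvexity, displayed), then `V = ⟪·, A·⟫ + P` has first-order modulus `2σ − h` — the letter
`…ConvexTiltMoment.exp_moment_le_of_uniformlyConvex` consumes (with `lam := 2σ − h`, useful when `h < 2σ`). [folklore] -/
theorem firstOrder_quadratic_add (A : EuclideanSpace ℝ (Fin n) →L[ℝ] EuclideanSpace ℝ (Fin n)) {σ h : ℝ}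
    (hA : ∀ v w : EuclideanSpace ℝ (Fin n), ⟪A v, w⟫ = ⟪v, A w⟫) (hσ : ∀ v : EuclideanSpace ℝ (Fin n), σ * ‖v‖ ^ 2 ≤ ⟪v, A v⟫)
    {P : EuclideanSpace ℝ (Fin n) → ℝ} (hP : Differentiable ℝ P)
    (hPsc : ∀ x y : EuclideanSpace ℝ (Fin n), P x + ⟪gradient P x, y - x⟫ + (-h) / 2 * ‖y - x‖ ^ 2 ≤ P y)
    (x y : EuclideanSpace ℝ (Fin n)) :
    (⟪x, A x⟫ + P x) + ⟪gradient (fun z : EuclideanSpace ℝ (Fin n) => ⟪z, A z⟫ + P z) x, y - x⟫ +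
        (2 * σ - h) / 2 * ‖y - x‖ ^ 2 ≤ ⟪y, A y⟫ + P y := by
  have := firstOrder_add (differentiable_quadratic A hA) hP (firstOrder_quadratic A hA hσ) hPsc x y
  have e : (2 * σ + -h) / 2 = (2 * σ - h) / 2 := by ring
  rw [e] at this
  exact this

/-- **«HESSIAN-SMALL ⇒ UNIFORMLY CONVEX»**: the same with the perturbation's semiconvexity supplied by a HESSIAN bound — `P ∈ C²` with
`D²P(x)[v, v] ≥ −h‖v‖²` — through the tree's `Literature.Analysis.FunctionSpaces.firstOrder_convex_of_hessian_lower` (which allows the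
negative constant `−h`).  In the refuter's letters: `σ = c₀ − q₀`, `h = C·ε_k`, modulus `λ₁ = 2(c₀ − q₀) − C·ε_k`. [folklore] -/
theorem firstOrder_quadratic_add_of_hessian (A : EuclideanSpace ℝ (Fin n) →L[ℝ] EuclideanSpace ℝ (Fin n)) {σ h : ℝ}
    (hA : ∀ v w : EuclideanSpace ℝ (Fin n), ⟪A v, w⟫ = ⟪v, A w⟫) (hσ : ∀ v : EuclideanSpace ℝ (Fin n), σ * ‖v‖ ^ 2 ≤ ⟪v, A v⟫)
    {P : EuclideanSpace ℝ (Fin n) → ℝ} (hP : ContDiff ℝ 2 P)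
    (hH : ∀ x v : EuclideanSpace ℝ (Fin n), -h * ‖v‖ ^ 2 ≤ iteratedFDeriv ℝ 2 P x ![v, v])
    (x y : EuclideanSpace ℝ (Fin n)) :
    (⟪x, A x⟫ + P x) + ⟪gradient (fun z : EuclideanSpace ℝ (Fin n) => ⟪z, A z⟫ + P z) x, y - x⟫ +
        (2 * σ - h) / 2 * ‖y - x‖ ^ 2 ≤ ⟪y, A y⟫ + P y :=
  firstOrder_quadratic_add A hA hσ (hP.differentiable (by norm_num))
    (fun x y => firstOrder_convex_of_hessian_lower hP hH x y) x y

end Summit.QuantumFields.BalabanUV.T4Continuum.NE7b.ConvexTiltSuppliers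

end
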